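import Literature.NumberTheory.EllipticCurves.OrdinaryFormalGroupLubinTate
import Literature.NumberTheory.EllipticCurves.ComplexMultiplicationLocalFactorsAux
import HarnessLib

/-!
# The formal group of `X₀(49) = 49a1` over `ℤ₂` is the Lubin–Tate group of `[π]`, `π = 1 − ϖ`, `ϖ² − ϖ + 2 = 0`
# (de Shalit II.1.10 for `K = ℚ(√−7)`, `𝔭 ∣ 2` split; Perrin-Riou's first example — proofs only)

Topic `NumberTheory/EllipticCurves` (theorems only; no definition, no named fact, no instance).  The curve
`49a1 = [1, −1, 0, −2, −1]` (`X₀(49)`, CM by `𝒪_K`, `K = ℚ(√−7)`, the tree's `cm7`; `Δ = −7³`) has good ORDINARY reduction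
at `2` (`a₂ = 1`: `#Ẽ(𝔽₂) = 2`, the tree's `natCard_point_F2_two`), and `2 = ππ̄` splits in `K` with
`π, π̄ = (1 ± √−7)/2` the roots of `T² − T + 2`; in `ℤ₂ = 𝒪_{K_v}` one root `ϖ` is a unit and the other `π = 1 − ϖ = ψ(v)`
is a uniformiser (Perrin-Riou 1984, Ch. III §1.2, table p. 54: `y² = 4x³ − 35x − 49`, `K = ℚ(√−7)`, `p = 2`).  Instantiating
`OrdinaryFormalGroupLubinTate`:
* `cm7Padic_map_toZMod`, `cm7Padic_tr_two` (`a₂ = 1`), `isElliptic_cm7Padic_map_toZMod`, `isElliptic_cm7Padic_map_coe`;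
* `cm7Padic_exists_unit_root_two` — a unit root `ϖ ∈ ℤ₂ˣ` of `T² − a₂T + 2`;
* ★ `cm7Padic_formalGroupLaw_eq_ltF` — for any such `ϖ` and any integral lift `P` of `exp_W((a₂ − ϖ) log_W)`:
  `IsLTSeries (a₂ − ϖ) 2 P` and **`(49a1 ⊗ ℤ₂).formalGroupLaw = LubinTate.ltF _ _`** — the formal group of `X₀(49)` at the
  split prime `2` IS a Lubin–Tate group of height one over `ℤ₂` (de Shalit II.1.10), the local model of the measure lane of
  cell `bsd-print-cf2` at `d_K = −7` (seat `bsd-line-cf2c-w4` g12).  No summit statement is proved.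

## References
* [deShalit1987] E. de Shalit, *Iwasawa theory of elliptic curves with complex multiplication* (1987), II §1.10 Lemma.
* [Perrinriou1984] B. Perrin-Riou, Mém. SMF 17 (1984), Ch. III §1.2 (table p. 54: `X₀(49)`, `K = ℚ(√−7)`, `p = 2`).
* [Cremona1997] J. E. Cremona, *Algorithms for Modular Elliptic Curves* (1997), Table 1 (curve 49a1: `a₂ = 1`).
* [LubinTate1965] J. Lubin, J. Tate, Ann. of Math. 81 (1965), §1.
-/

noncomputable section

open scoped Classical
open PowerSeries Literature.NumberTheory.EllipticCurves Literature.NumberTheory.GaloisRepresentations.LubinTate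

namespace WeierstrassCurve

/-- `49a1 ⊗ 𝔽₂ = [1, 1, 0, 0, 1]`: `y² + xy = x³ + x² + 1`. [cite: Cremona1997, Table 1 (curve 49a1)] -/
theorem cm7Padic_map_toZMod :
    (⟨1, -1, 0, -2, -1⟩ : WeierstrassCurve ℤ_[2]).map PadicInt.toZMod = ⟨1, 1, 0, 0, 0 + 1⟩ := by
  ext <;> simp only [map_a₁, map_a₂, map_a₃, map_a₄, map_a₆, map_one, map_neg, map_zero, map_ofNat] <;> decide

/-- **`a₂(49a1) = 2 + 1 − #Ẽ(𝔽₂) = 1`** (ordinary). [cite: Cremona1997, Table 1 (curve 49a1)] -/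
theorem cm7Padic_tr_two :
    Literature.NumberTheory.EllipticCurves.HasseManin.tr ((⟨1, -1, 0, -2, -1⟩ : WeierstrassCurve ℤ_[2]).map PadicInt.toZMod) = 1 := by
  rw [cm7Padic_map_toZMod, Literature.NumberTheory.EllipticCurves.HasseManin.tr, natCard_point_F2_two 0, ZMod.card]
  norm_num

/-- `49a1 ⊗ 𝔽₂` is an elliptic curve (`Δ̃ = 1`). [cite: Cremona1997, Table 1 (curve 49a1: N = 49)] -/
theorem isElliptic_cm7Padic_map_toZMod : (((⟨1, -1, 0, -2, -1⟩ : WeierstrassCurve ℤ_[2]).map PadicInt.toZMod)).IsElliptic := by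
  rw [cm7Padic_map_toZMod, isElliptic_iff]
  decide

/-- `49a1 ⊗ ℚ₂` is an elliptic curve (`Δ = −343 ≠ 0`). [cite: Cremona1997, Table 1 (curve 49a1)] -/
theorem isElliptic_cm7Padic_map_coe : (((⟨1, -1, 0, -2, -1⟩ : WeierstrassCurve ℤ_[2]).map PadicInt.Coe.ringHom)).IsElliptic := by
  have hW : (⟨1, -1, 0, -2, -1⟩ : WeierstrassCurve ℤ_[2]).map PadicInt.Coe.ringHom = (⟨1, -1, 0, -2, -1⟩ : WeierstrassCurve ℚ_[2]) := by
    ext <;> simp [map_a₁, map_a₂, map_a₃, map_a₄, map_a₆]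
    norm_cast
  rw [hW, isElliptic_iff, isUnit_iff_ne_zero]
  simp only [Δ, b₂, b₄, b₆, b₈]
  norm_num

/-- **A unit root `ϖ ∈ ℤ₂ˣ` of `T² − a₂T + 2`** (`a₂ = 1` is a unit; Hensel): `ϖ = (1 ± √−7)/2`, the conjugate `π*` of the
uniformiser in Perrin-Riou's notation. [cite: Perrinriou1984, Ch. III §1.2 (table p. 54)] [cite: deShalit1987, Ch. II §1.10] -/
theorem cm7Padic_exists_unit_root_two : ∃ ϖ : ℤ_[2], IsUnit ϖ ∧
    ϖ ^ 2 - (Literature.NumberTheory.EllipticCurves.HasseManin.tr ((⟨1, -1, 0, -2, -1⟩ : WeierstrassCurve ℤ_[2]).map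
      PadicInt.toZMod) : ℤ_[2]) * ϖ + (2 : ℕ) = 0 := by
  rw [cm7Padic_tr_two, Int.cast_one]
  exact exists_isUnit_sq_sub_mul_add_eq_zero isUnit_one

/-- ★ **The formal group of `X₀(49)` over `ℤ₂` is Lubin–Tate**: for a unit root `ϖ` of `T² − a₂T + 2` and any integral lift `P`
of `[a₂ − ϖ] = exp_W((a₂ − ϖ) log_W)`, `P ∈ 𝔉_{a₂ − ϖ}` over `(ℤ₂, a₂ − ϖ, 2)` and `(49a1 ⊗ ℤ₂).formalGroupLaw = F_P` — de Shalit
II.1.10 for `K = ℚ(√−7)`, `𝔭 = v ∣ 2` split of degree one, `ψ(v) = a₂ − ϖ`. [cite: deShalit1987, Ch. II §1.10 Lemma]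
[cite: Perrinriou1984, Ch. III §1.2] -/
theorem cm7Padic_formalGroupLaw_eq_ltF {ϖ : ℤ_[2]} (hϖ : IsUnit ϖ)
    (hroot : ϖ ^ 2 - (Literature.NumberTheory.EllipticCurves.HasseManin.tr ((⟨1, -1, 0, -2, -1⟩ : WeierstrassCurve ℤ_[2]).map
      PadicInt.toZMod) : ℤ_[2]) * ϖ + (2 : ℕ) = 0)
    {P : ℤ_[2]⟦X⟧} (hP : P.map PadicInt.Coe.ringHom =
      ((⟨1, -1, 0, -2, -1⟩ : WeierstrassCurve ℤ_[2]).map PadicInt.Coe.ringHom).formalExp.subst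
        (C (((Literature.NumberTheory.EllipticCurves.HasseManin.tr ((⟨1, -1, 0, -2, -1⟩ : WeierstrassCurve ℤ_[2]).map
          PadicInt.toZMod) : ℤ_[2]) - ϖ : ℤ_[2]) : ℚ_[2]) *
          ((⟨1, -1, 0, -2, -1⟩ : WeierstrassCurve ℤ_[2]).map PadicInt.Coe.ringHom).formalLog)) :
    ∃ hf : IsLTSeries ((Literature.NumberTheory.EllipticCurves.HasseManin.tr ((⟨1, -1, 0, -2, -1⟩ : WeierstrassCurve ℤ_[2]).map
        PadicInt.toZMod) : ℤ_[2]) - ϖ) 2 P,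
      (⟨1, -1, 0, -2, -1⟩ : WeierstrassCurve ℤ_[2]).formalGroupLaw = ltF (isLTRing_of_root (p := 2) hϖ hroot) hf := by
  haveI := isElliptic_cm7Padic_map_toZMod
  haveI := isElliptic_cm7Padic_map_coe
  exact ⟨isLTSeries_of_root _ hϖ hroot hP, formalGroupLaw_eq_ltF_of_root _ hϖ hroot hP⟩

/-- The same with the lift produced: **`∃ P ∈ 𝔉_{a₂ − ϖ}` with `P ↦ [a₂ − ϖ]` and `(49a1 ⊗ ℤ₂)^ = F_P`**.
[cite: deShalit1987, Ch. II §1.10 Lemma] [cite: Perrinriou1984, Ch. III §1.2] -/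
theorem cm7Padic_exists_formalGroupLaw_eq_ltF {ϖ : ℤ_[2]} (hϖ : IsUnit ϖ)
    (hroot : ϖ ^ 2 - (Literature.NumberTheory.EllipticCurves.HasseManin.tr ((⟨1, -1, 0, -2, -1⟩ : WeierstrassCurve ℤ_[2]).map
      PadicInt.toZMod) : ℤ_[2]) * ϖ + (2 : ℕ) = 0) :
    ∃ P : ℤ_[2]⟦X⟧, P.map PadicInt.Coe.ringHom =
      ((⟨1, -1, 0, -2, -1⟩ : WeierstrassCurve ℤ_[2]).map PadicInt.Coe.ringHom).formalExp.subst
        (C (((Literature.NumberTheory.EllipticCurves.HasseManin.tr ((⟨1, -1, 0, -2, -1⟩ : WeierstrassCurve ℤ_[2]).map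
          PadicInt.toZMod) : ℤ_[2]) - ϖ : ℤ_[2]) : ℚ_[2]) *
          ((⟨1, -1, 0, -2, -1⟩ : WeierstrassCurve ℤ_[2]).map PadicInt.Coe.ringHom).formalLog) ∧
      ∃ hf : IsLTSeries ((Literature.NumberTheory.EllipticCurves.HasseManin.tr ((⟨1, -1, 0, -2, -1⟩ : WeierstrassCurve ℤ_[2]).map
        PadicInt.toZMod) : ℤ_[2]) - ϖ) 2 P,
      (⟨1, -1, 0, -2, -1⟩ : WeierstrassCurve ℤ_[2]).formalGroupLaw = ltF (isLTRing_of_root (p := 2) hϖ hroot) hf := by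
  haveI := isElliptic_cm7Padic_map_toZMod
  haveI := isElliptic_cm7Padic_map_coe
  exact exists_isLTSeries_formalGroupLaw_eq_ltF _ hϖ hroot

end WeierstrassCurve
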